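import Summits.ABC.IUTFork.LDHGenuinePerImageLevelPoleL
import Summits.ABC.IUTFork.LDHGenuinePerImageUniform
import Summits.ABC.IUTFork.LDHGenuinePerImageSharpWildPoleLRat
import HarnessLib

/-!
# The fork at [IUTchIII] Corollary 3.12, L-DH level, READING (P): the UNIFORM POLE-`l` SHELL THEOREM, part 2 — the SLOPE LINE WITH THE
# POLE TERM, every prime `l ≥ l₀`, poles INCLUDED (abc-iut cell, crux ThetaPartII = stmt-ABC-19678; R-H round-4 census row O-18 residual
# R-P, KEY R4O18-UPOLEL; family «C:PERIMAGE-LEVEL»; part 1 = `LDHGenuinePerImageLevelPoleL`)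

Record-only PROOF file (D-0012) of the abc-iut cell (seat abc-iut-L5-t8, gen 14). TAKES NO SIDE on [IUTchIII] Cor. 3.12.
`q ∈ ℚ ∖ {0, 1}`, `j(q) = N/D` in lowest terms, `D = ∏_{p∈I} p^{e_p}` (`I` primes, `e_p ≥ 1`, `p ∤ N`); `Q₀ := Σ_{p∈I, p≠2} e_p·log p =
log D_odd`, `C₀ := Σ_{p∈I, p≠2} log p = log rad_odd(D)`. BY NAME over abc-iut-s2-p4's SLOPE TEST `Cor22.cor312PerImageOf_ratPoint_uniform`
(`LDHGenuinePerImageUniform`, p476979, over p471287) — «the slope test at ONE `l₀` decides every prime `l ≥ l₀` OFF the poles» — and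
abc-iut-rcat-tst-1's POLE-`l` test `Cor22.cor312PerImageOf_ratPoint_sharp_wild_poleL` (★ p541073; weight `2 − 1/(l−1)` at the pole `l`,
from ★ p539739 `GenuineK.two_sub_inv_le_differentOrd_kOf_pole_ratPoint`); the dictionary at `{2, l}` for any prime `l` is part 1's
`logQAvoid_ratPoint_two_prime_eq_sum_ne` / `logCondAvoid_ratPoint_two_prime_eq_sum_ne`. Nothing of those tests is re-proved here.

* **(T4) `Cor22.cor312PerImageOf_ratPoint_uniform_poleL`** — THE SLOPE LINE WITH THE POLE TERM: reals `Q ≥ Q₀`, `0 ≤ C ≤ C₀` with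
  `Q ≤ 6·((1 − 1/l₀)·C + (1 − 1/(l₀−1))·log l₀ + log π)` at some `l₀ ≥ 7` give `T.Cor312PerImageOf` at every genuine Θ-volume datum
  `T` of `(q, l)` for EVERY prime `l ≥ l₀` such that, IF `l` is a pole, `2 ∣ e_l` or `e_l ≥ 6` (automatic for the Frey–Legendre data of
  the cell's tables, whose odd pole orders are even). Three cases BY NAME: `l ∉ I` is p476979 verbatim (`log q^{∤2l} = Q₀`,
  `log 𝔣^{∤2l} = C₀`); at a pole with `e_l ≥ 6` (in particular `l ∣ e_l/2`, where `e_l ≥ 2l`) p476979 at `l₀ := l`, `C := C₀ − log l`: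
  the `q`-side DROP `e_l·log l ≥ 6·(1 − 1/l)·log l` pays the conductor's loss of `log l`; at a pole with `e_l ∈ {2, 4}` (`l ∤ e_l/2`)
  ★ p541073: the pole weight's extra `log l` pays it (`(1 − 1/l)·log l + (1 − 1/(l−1))·log l ≤ (2 − 1/(l−1))·log l`, every other
  floor `χ_p − 1/(l·k_p) ≥ 1 − 1/l`, `log 2 ≥ 0`).
* `…_of_forall_even` (all pole orders even: EVERY prime `l ≥ l₀`, no pole clause) and `cor312PerImageAtDatum_ratPoint_uniform_poleL`
  (both readings at the Θ-data of `(q, l)`).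

SUBSUMPTION (said, not re-filed; R101): p476979's §2–§7 slope certificates (`reyssat_slope`, …) feed (T4) unchanged — their «every prime
`l ≥ l₀` OUTSIDE the denominator» reads «every prime `l ≥ l₀`» through (T4) (all their odd pole orders are even); the per-row pole-`l` files
`LDHGenuinePerImageSharpWildPoleLRows{A…G}`, `LDHGenuinePerImageShellPoleLRows{A,B}` and the `…FreyRows…` / `…UniformShellRows…` instances
stay the theorems of record for their rows; (T4) decides a tabulated `(q, l)` by ONE `exact` whenever the triple sits below the slope line at
some `l₀ ≤ l` (desk counts on the cell's STATUS line of this file; rows above the slope line but below their own sharp certificates are NOT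
subsumed). HONEST SCOPE: statements about OUR typed reading (P) (`Cor22.ThetaVolumeDatumAt.Cor312PerImageOf`, container (Ind2) = the
tree's FULL lattice-automorphism indeterminacy) at rational data. Nothing asserts that genuine Θ-data exist at these `(q, l)`, Cor. 3.12 in
general or in print's reading, or abc; proved-as-typed ≠ in print; located ≠ adjudicated. [cite: Mochizuki2012, IUTchI Def. 3.1 (a)(b)(c)
p. 61–62; IUTchIII Cor. 3.12 p. 173–174, proof Step (x) p. 181; IUTchIV Prop. 1.2 (i)(ii) p. 10, Thm. 1.10 p. 22–23, Step (ii) p. 24,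
Step (v) p. 27–29] [cite: DupuyHilado2025, §4.9, §4.12] [claim: Mochizuki2012, status: disputed] for every IUT quotation. PROOF-ONLY: no
definitions, no new `Prop`, no instance, no notation.
-/

noncomputable section

open NumberField IsDedekindDomain Ideal Module

namespace Literature.IUT.LogVolume.Cor22

open Literature.NumberTheory.DiophantineGeometry.GenEll Summit.ABC.IUTFork Literature.IUT.HodgeTheaters
open Literature.NumberTheory.DiophantineGeometry.UniformABCConjecture

variable {q : ℚ} {N D : ℕ} {I : Finset ℕ} {e : ℕ → ℕ} {l : ℕ}

/-! ## 0. Two helpers -/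

/-- At a POLE `l ∈ I` (`l ≠ 2`): `{p ∈ I : p ≠ 2, p ≠ l}` is `{p ∈ I : p ≠ 2}` with `l` erased. [folklore] -/
private theorem filter_ne_two_ne_eq_erase (I : Finset ℕ) (l : ℕ) :
    I.filter (fun p => p ≠ 2 ∧ p ≠ l) = (I.filter (fun p => p ≠ 2)).erase l := by
  ext p
  simp only [Finset.mem_filter, Finset.mem_erase]
  tauto

/-- The slope bracket `(1 − 1/x)·C + (1 − 1/(x−1))·log x` is monotone on `5 ≤ x` for `C ≥ 0` (p476979's steps (2)–(3)). [folklore] -/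
private theorem slope_bracket_mono {L l : ℕ} (hL : 5 ≤ L) (hLl : L ≤ l) {C : ℝ} (hC : 0 ≤ C) :
    (1 - 1 / (L : ℝ)) * C + (1 - 1 / ((L : ℝ) - 1)) * Real.log L ≤
      (1 - 1 / (l : ℝ)) * C + (1 - 1 / ((l : ℝ) - 1)) * Real.log l := by
  have hL₀ : (5 : ℝ) ≤ L := by exact_mod_cast hL
  have hLL : (L : ℝ) ≤ l := by exact_mod_cast hLl
  have hlog₀ : 0 < Real.log L := Real.log_pos (by linarith)
  have hlogle : Real.log L ≤ Real.log l := Real.log_le_log (by linarith) hLL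
  have h2 : (1 - 1 / (L : ℝ)) * C ≤ (1 - 1 / (l : ℝ)) * C := by
    have ha : 1 - 1 / (L : ℝ) ≤ 1 - 1 / (l : ℝ) := by
      have h := one_div_le_one_div_of_le (by linarith : (0 : ℝ) < L) hLL
      linarith
    exact mul_le_mul_of_nonneg_right ha hC
  have h3 : (1 - 1 / ((L : ℝ) - 1)) * Real.log L ≤ (1 - 1 / ((l : ℝ) - 1)) * Real.log l := by
    have ha : 1 - 1 / ((L : ℝ) - 1) ≤ 1 - 1 / ((l : ℝ) - 1) := by
      have h := one_div_le_one_div_of_le (by linarith : (0 : ℝ) < (L : ℝ) - 1)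
        (by linarith : (L : ℝ) - 1 ≤ (l : ℝ) - 1)
      linarith
    have hb : 0 ≤ 1 - 1 / ((L : ℝ) - 1) := by
      have h : 1 / ((L : ℝ) - 1) ≤ 1 := (div_le_one (by linarith)).mpr (by linarith)
      linarith
    calc (1 - 1 / ((L : ℝ) - 1)) * Real.log L ≤ (1 - 1 / ((l : ℝ) - 1)) * Real.log L :=
        mul_le_mul_of_nonneg_right ha hlog₀.le
      _ ≤ (1 - 1 / ((l : ℝ) - 1)) * Real.log l := mul_le_mul_of_nonneg_left hlogle (hb.trans ha)
  linarith

/-! ## 1. (T4): the SLOPE LINE with the pole term — every prime `l ≥ l₀`, poles included -/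

/-- **(T4) THE SLOPE TEST WITH THE POLE TERM (uniform in the prime `l ≥ l₀`, poles INCLUDED).** `q ∈ ℚ ∖ {0,1}`,
`j(q) = N/∏_{p∈I} p^{e_p}` in lowest terms; reals `Q ≥ Σ_{p∈I, p≠2} e_p·log p` and `0 ≤ C ≤ Σ_{p∈I, p≠2} log p` with
`Q ≤ 6·((1 − 1/l₀)·C + (1 − 1/(l₀−1))·log l₀ + log π)` for some `l₀ ≥ 7`. Then for EVERY prime `l ≥ l₀` such that `2 ∣ e_l` or
`e_l ≥ 6` IF `l ∈ I` is a pole, and every genuine Θ-volume datum `T` of `(q, l)`: `T.Cor312PerImageOf` ([IUTchIII] Cor. 3.12 in the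
cell's READING (P), AS TYPED). Cases BY NAME: `l ∉ I` — p476979; pole with `e_l ≥ 6` — p476979 at `l₀ := l`, `C := C₀ − log l`
(the `q`-side drop `e_l·log l ≥ 6(1 − 1/l)·log l`); pole with `e_l ∈ {2,4}` — ★ p541073 (weight `2 − 1/(l−1)` at `l`).
[cite: Mochizuki2012, IUTchIII Cor. 3.12 p. 173–174; IUTchIV Thm. 1.10 p. 22–23, Step (ii) p. 24, Step (v) p. 27–29]
[claim: Mochizuki2012, status: disputed] -/
theorem cor312PerImageOf_ratPoint_uniform_poleL (hq0 : q ≠ 0) (hq1 : q ≠ 1)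
    (hI : ∀ p ∈ I, p.Prime) (he : ∀ p ∈ I, e p ≠ 0) (hD : D = ∏ p ∈ I, p ^ e p)
    (hj : jInv q = (N : ℚ) / (D : ℚ)) (hN : N ≠ 0) (hcop : ∀ p ∈ I, ¬ p ∣ N)
    {l₀ : ℕ} (h7 : 7 ≤ l₀) {Q C : ℝ} (hC0 : 0 ≤ C)
    (hslope : Q ≤ 6 * ((1 - 1 / (l₀ : ℝ)) * C + (1 - 1 / ((l₀ : ℝ) - 1)) * Real.log l₀ + Real.log Real.pi))
    (hQ : (∑ p ∈ I.filter (fun p => p ≠ 2), (e p : ℝ) * Real.log p) ≤ Q)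
    (hC : C ≤ ∑ p ∈ I.filter (fun p => p ≠ 2), Real.log p)
    (hl : l.Prime) (hle : l₀ ≤ l) (hpole : l ∈ I → 2 ∣ e l ∨ 6 ≤ e l)
    (T : ThetaVolumeDatumAt (ratPoint q) l) : T.Cor312PerImageOf := by
  classical
  have h7l : 7 ≤ l := h7.trans hle
  have h5 : 5 ≤ l₀ := by omega
  have hl2 : l ≠ 2 := by omega
  have hlR : (7 : ℝ) ≤ l := by exact_mod_cast h7l
  have hlpos : (0 : ℝ) < l := by linarith
  have hQeq := logQAvoid_ratPoint_two_prime_eq_sum_ne hI he hD hj hN hcop hl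
  have hCeq := logCondAvoid_ratPoint_two_prime_eq_sum_ne hI he hD hj hN hcop hl
  have hlogp : ∀ p ∈ I, 0 ≤ Real.log (p : ℝ) := fun p hp =>
    Real.log_nonneg (by exact_mod_cast (hI p hp).one_lt.le)
  by_cases hlI : l ∈ I
  · -- `l` IS A POLE: split the two dictionary sums at `l`
    have hl2I : l ∈ I.filter (fun p => p ≠ 2) := Finset.mem_filter.mpr ⟨hlI, hl2⟩
    have hQsplit : (∑ p ∈ I.filter (fun p => p ≠ 2), (e p : ℝ) * Real.log p) =
        (∑ p ∈ I.filter (fun p => p ≠ 2 ∧ p ≠ l), (e p : ℝ) * Real.log p) + (e l : ℝ) * Real.log l := by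
      rw [filter_ne_two_ne_eq_erase]
      exact (Finset.sum_erase_add _ _ hl2I).symm
    have hCsplit : (∑ p ∈ I.filter (fun p => p ≠ 2), Real.log p) =
        (∑ p ∈ I.filter (fun p => p ≠ 2 ∧ p ≠ l), Real.log p) + Real.log l := by
      rw [filter_ne_two_ne_eq_erase]
      exact (Finset.sum_erase_add _ _ hl2I).symm
    have hX0 : 0 ≤ ∑ p ∈ I.filter (fun p => p ≠ 2 ∧ p ≠ l), (e p : ℝ) * Real.log p :=
      Finset.sum_nonneg fun p hp => mul_nonneg (Nat.cast_nonneg _) (hlogp p (Finset.mem_filter.mp hp).1)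
    have hR0 : 0 ≤ ∑ p ∈ I.filter (fun p => p ≠ 2 ∧ p ≠ l), Real.log p :=
      Finset.sum_nonneg fun p hp => hlogp p (Finset.mem_filter.mp hp).1
    have hC0' : 0 ≤ ∑ p ∈ I.filter (fun p => p ≠ 2), Real.log p := hC0.trans hC
    have hlogl : 0 ≤ Real.log l := Real.log_nonneg (by linarith)
    -- the slope bracket at `l`, with the TRUE conductor sum `C₀`
    have hmono := slope_bracket_mono h5 hle hC0
    have hCmono : (1 - 1 / (l : ℝ)) * C ≤ (1 - 1 / (l : ℝ)) * ∑ p ∈ I.filter (fun p => p ≠ 2), Real.log p := by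
      have hb : 0 ≤ 1 - 1 / (l : ℝ) := by
        have h : 1 / (l : ℝ) ≤ 1 := (div_le_one hlpos).mpr (by linarith)
        linarith
      exact mul_le_mul_of_nonneg_left hC hb
    have hBr : (∑ p ∈ I.filter (fun p => p ≠ 2), (e p : ℝ) * Real.log p) ≤
        6 * ((1 - 1 / (l : ℝ)) * (∑ p ∈ I.filter (fun p => p ≠ 2), Real.log p)
          + (1 - 1 / ((l : ℝ) - 1)) * Real.log l + Real.log Real.pi) := by
      linarith [hQ, hslope, hmono, hCmono]
    rcases (show 6 ≤ e l ∨ e l < 6 by omega) with h6 | hlt6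
    · -- (b) `e_l ≥ 6`: p476979 at `l₀ := l`, `C := C₀ − log l`; the `q`-side drops by `e_l·log l ≥ 6(1 − 1/l)·log l`
      have h6R : (6 : ℝ) ≤ e l := by exact_mod_cast h6
      refine cor312PerImageOf_ratPoint_uniform hq0 hq1 (by omega : 5 ≤ l)
        (Q := (∑ p ∈ I.filter (fun p => p ≠ 2), (e p : ℝ) * Real.log p) - (e l : ℝ) * Real.log l)
        (C := (∑ p ∈ I.filter (fun p => p ≠ 2), Real.log p) - Real.log l) ?_ ?_ hl le_rfl ?_ ?_ T
      · rw [hCsplit]; linarith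
      · have ha : 0 ≤ ((e l : ℝ) - 6) * Real.log l := mul_nonneg (by linarith) hlogl
        have hb : 0 ≤ 1 / (l : ℝ) * Real.log l := mul_nonneg (by positivity) hlogl
        nlinarith [hBr, ha, hb]
      · rw [hQeq, hQsplit]; linarith
      · rw [hCeq, hCsplit]; linarith
    · -- (a) `e_l ∈ {2, 4}`: even and `l ∤ e_l/2` — the pole-`l` test ★ p541073
      have hev : 2 ∣ e l := by
        rcases hpole hlI with h | h
        · exact h
        · omega
      have hndvd : ¬ l ∣ e l / 2 := by
        intro h
        have hpos : 0 < e l / 2 :=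
          Nat.div_pos (Nat.le_of_dvd (Nat.pos_of_ne_zero (he l hlI)) hev) two_pos
        have := Nat.le_of_dvd hpos h
        omega
      refine cor312PerImageOf_ratPoint_sharp_wild_poleL hq0 hq1 hl h7l hI he hD hj hN hcop hlI hev hndvd ?_ T
      rw [hQeq]
      set k : ℕ → ℕ := fun p => Nat.lcm (30 / Nat.gcd 30 (e p)) (if p = 3 then 2 else if p = 5 then 4 else 1) with hk
      have hkpos : ∀ p, 0 < k p := by
        intro p
        refine Nat.pos_of_ne_zero (Nat.lcm_ne_zero ?_ (by split_ifs <;> norm_num))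
        exact (Nat.div_pos (Nat.le_of_dvd (by norm_num) (Nat.gcd_dvd_left 30 (e p)))
          (Nat.gcd_pos_of_pos_left _ (by norm_num))).ne'
      -- the weights at the poles `p ≠ 2, l`: `χ_p − 1/(l·k_p) ≥ 1 − 1/l`
      have hWA : (1 - 1 / (l : ℝ)) * (∑ p ∈ I.filter (fun p => p ≠ 2 ∧ p ≠ l), Real.log p) ≤
          ∑ p ∈ I.filter (fun p => p ≠ 2 ∧ p ≠ l),
            ((if (p = 3 ∨ p = 5) ∧ 2 ∣ e p ∧ ¬ p ∣ e p / 2 then (2 : ℝ) else 1) - ((l * k p : ℕ) : ℝ)⁻¹) * Real.log p := by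
        rw [Finset.mul_sum]
        refine Finset.sum_le_sum fun p hp => ?_
        have hpI := (Finset.mem_filter.mp hp).1
        have hχ : (1 : ℝ) ≤ (if (p = 3 ∨ p = 5) ∧ 2 ∣ e p ∧ ¬ p ∣ e p / 2 then (2 : ℝ) else 1) := by
          split_ifs <;> norm_num
        have hlk : (l : ℝ) ≤ ((l * k p : ℕ) : ℝ) := by exact_mod_cast Nat.le_mul_of_pos_right l (hkpos p)
        have hinv : ((l * k p : ℕ) : ℝ)⁻¹ ≤ 1 / (l : ℝ) := by
          rw [one_div]; exact inv_anti₀ hlpos hlk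
        exact mul_le_mul_of_nonneg_right (by linarith) (hlogp p hpI)
      -- the pole term: `(1 − 1/l)·log l + (1 − 1/(l−1))·log l ≤ (2 − 1/(l−1))·log l`
      have hcast : ((l - 1 : ℕ) : ℝ)⁻¹ = 1 / ((l : ℝ) - 1) := by
        rw [Nat.cast_sub (by omega : 1 ≤ l), Nat.cast_one, one_div]
      have hL : (1 - 1 / (l : ℝ)) * Real.log l + (1 - 1 / ((l : ℝ) - 1)) * Real.log l ≤
          (2 - ((l - 1 : ℕ) : ℝ)⁻¹) * Real.log l := by
        rw [hcast]
        have hb : 0 ≤ 1 / (l : ℝ) * Real.log l := mul_nonneg (by positivity) hlogl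
        nlinarith [hb]
      have hc3 : 0 ≤ (if 3 ∈ I then 0 else 2⁻¹ * Real.log 3 : ℝ) := by
        split_ifs
        · exact le_rfl
        · exact mul_nonneg (by norm_num) (Real.log_nonneg (by norm_num))
      have hc5 : 0 ≤ (if 5 ∈ I then 0 else (3 / 4 : ℝ) * Real.log 5 : ℝ) := by
        split_ifs
        · exact le_rfl
        · exact mul_nonneg (by norm_num) (Real.log_nonneg (by norm_num))
      have hlog2 : 0 < Real.log 2 := Real.log_pos (by norm_num)
      have hpi : 0 < Real.log Real.pi := Real.log_pos (by linarith [Real.pi_gt_three])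
      -- the bracket at `l` is below the pole-`l` test's bracket
      have hBr_le : (1 - 1 / (l : ℝ)) * (∑ p ∈ I.filter (fun p => p ≠ 2), Real.log p)
            + (1 - 1 / ((l : ℝ) - 1)) * Real.log l + Real.log Real.pi ≤
          (∑ p ∈ I.filter (fun p => p ≠ 2 ∧ p ≠ l),
              ((if (p = 3 ∨ p = 5) ∧ 2 ∣ e p ∧ ¬ p ∣ e p / 2 then (2 : ℝ) else 1) - ((l * k p : ℕ) : ℝ)⁻¹) * Real.log p)
            + Real.log 2
            + (if 3 ∈ I then 0 else 2⁻¹ * Real.log 3)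
            + (if 5 ∈ I then 0 else (3 / 4 : ℝ) * Real.log 5)
            + (2 - ((l - 1 : ℕ) : ℝ)⁻¹) * Real.log l
            + Real.log Real.pi := by
        rw [hCsplit, mul_add]
        linarith [hWA, hL, hc3, hc5, hlog2]
      -- assemble: `κ_l·X ≤ (l+1)/24·X ≤ (l+1)/24·Q₀ ≤ (l+1)/4·bracket(l) ≤ RHS`
      have hl1 : (0 : ℝ) ≤ ((l : ℝ) + 1) / 4 := by positivity
      have h1 : (((l : ℝ) + 1) / 24 - 1 / (2 * l)) * (∑ p ∈ I.filter (fun p => p ≠ 2 ∧ p ≠ l), (e p : ℝ) * Real.log p) ≤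
          ((l : ℝ) + 1) / 24 * (∑ p ∈ I.filter (fun p => p ≠ 2 ∧ p ≠ l), (e p : ℝ) * Real.log p) := by
        have h0 : 0 ≤ 1 / (2 * (l : ℝ)) * (∑ p ∈ I.filter (fun p => p ≠ 2 ∧ p ≠ l), (e p : ℝ) * Real.log p) := by
          positivity
        rw [sub_mul]
        linarith
      have hXle : (∑ p ∈ I.filter (fun p => p ≠ 2 ∧ p ≠ l), (e p : ℝ) * Real.log p) ≤
          ∑ p ∈ I.filter (fun p => p ≠ 2), (e p : ℝ) * Real.log p := by
        rw [hQsplit]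
        have : 0 ≤ (e l : ℝ) * Real.log l := mul_nonneg (Nat.cast_nonneg _) hlogl
        linarith
      have h2 := mul_le_mul_of_nonneg_left hXle (by positivity : (0 : ℝ) ≤ ((l : ℝ) + 1) / 24)
      have h3 := mul_le_mul_of_nonneg_left hBr (by positivity : (0 : ℝ) ≤ ((l : ℝ) + 1) / 24)
      have h4 := mul_le_mul_of_nonneg_left hBr_le hl1
      linarith [h1, h2, h3, h4, hpi]
  · -- `l` IS NOT A POLE: p476979 verbatim (`log q^{∤2l} = Q₀`, `log 𝔣^{∤2l} = C₀`)
    have hfilter : I.filter (fun p => p ≠ 2 ∧ p ≠ l) = I.filter (fun p => p ≠ 2) := by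
      refine Finset.filter_congr fun p hp => ?_
      exact ⟨fun h => h.1, fun h => ⟨h, fun hpl => hlI (hpl ▸ hp)⟩⟩
    refine cor312PerImageOf_ratPoint_uniform hq0 hq1 h5 hC0 hslope hl hle ?_ ?_ T
    · rw [hQeq, hfilter]; exact hQ
    · rw [hCeq, hfilter]; exact hC

/-- **(T4, all pole orders even)**: if every pole order `e_p` is even (the Frey–Legendre data), the slope test at `l₀ ≥ 7` gives the typed
per-image Corollary at EVERY prime `l ≥ l₀`, poles included, for every genuine Θ-volume datum. [cite: Mochizuki2012, IUTchIII Cor. 3.12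
p. 173–174; IUTchIV Thm. 1.10 Step (v) p. 27–29] [claim: Mochizuki2012, status: disputed] -/
theorem cor312PerImageOf_ratPoint_uniform_poleL_of_forall_even (hq0 : q ≠ 0) (hq1 : q ≠ 1)
    (hI : ∀ p ∈ I, p.Prime) (he : ∀ p ∈ I, e p ≠ 0) (hD : D = ∏ p ∈ I, p ^ e p)
    (hj : jInv q = (N : ℚ) / (D : ℚ)) (hN : N ≠ 0) (hcop : ∀ p ∈ I, ¬ p ∣ N)
    (heven : ∀ p ∈ I, 2 ∣ e p)
    {l₀ : ℕ} (h7 : 7 ≤ l₀) {Q C : ℝ} (hC0 : 0 ≤ C)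
    (hslope : Q ≤ 6 * ((1 - 1 / (l₀ : ℝ)) * C + (1 - 1 / ((l₀ : ℝ) - 1)) * Real.log l₀ + Real.log Real.pi))
    (hQ : (∑ p ∈ I.filter (fun p => p ≠ 2), (e p : ℝ) * Real.log p) ≤ Q)
    (hC : C ≤ ∑ p ∈ I.filter (fun p => p ≠ 2), Real.log p)
    (hl : l.Prime) (hle : l₀ ≤ l) (T : ThetaVolumeDatumAt (ratPoint q) l) : T.Cor312PerImageOf :=
  cor312PerImageOf_ratPoint_uniform_poleL hq0 hq1 hI he hD hj hN hcop h7 hC0 hslope hQ hC hl hle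
    (fun h => Or.inl (heven l h)) T

/-- **(T4) in both readings at the Θ-data of `(q, l)`**: `Cor312PerImageAtDatum ∧ Cor312AtDatum` at every prime `l ≥ l₀` under the
slope test with the pole clause. [cite: Mochizuki2012, IUTchIII Cor. 3.12 p. 173–174] [claim: Mochizuki2012, status: disputed] -/
theorem cor312PerImageAtDatum_ratPoint_uniform_poleL (hq0 : q ≠ 0) (hq1 : q ≠ 1)
    (hI : ∀ p ∈ I, p.Prime) (he : ∀ p ∈ I, e p ≠ 0) (hD : D = ∏ p ∈ I, p ^ e p)
    (hj : jInv q = (N : ℚ) / (D : ℚ)) (hN : N ≠ 0) (hcop : ∀ p ∈ I, ¬ p ∣ N)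
    {l₀ : ℕ} (h7 : 7 ≤ l₀) {Q C : ℝ} (hC0 : 0 ≤ C)
    (hslope : Q ≤ 6 * ((1 - 1 / (l₀ : ℝ)) * C + (1 - 1 / ((l₀ : ℝ) - 1)) * Real.log l₀ + Real.log Real.pi))
    (hQ : (∑ p ∈ I.filter (fun p => p ≠ 2), (e p : ℝ) * Real.log p) ≤ Q)
    (hC : C ≤ ∑ p ∈ I.filter (fun p => p ≠ 2), Real.log p)
    (hl : l.Prime) (hle : l₀ ≤ l) (hpole : l ∈ I → 2 ∣ e l ∨ 6 ≤ e l) :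
    Cor312PerImageAtDatum (ratPoint q) l ∧ Cor312AtDatum (ratPoint q) l :=
  have h : Cor312PerImageAtDatum (ratPoint q) l :=
    fun T => cor312PerImageOf_ratPoint_uniform_poleL hq0 hq1 hI he hD hj hN hcop h7 hC0 hslope hQ hC hl hle hpole T
  ⟨h, cor312AtDatum_of_perImage h⟩

end Literature.IUT.LogVolume.Cor22

end
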